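import Mathlib.Topology.Order.IntermediateValue
import Literature.Probability.LatticeModels.ClusterExpansion
import Literature.Probability.LatticeModels.PolymerGasGeometric
import HarnessLib

/-!
# Polymer gases: ratios of partition functions with modified activities, real activities, tails

A third layer on `PolymerGas` / `ClusterExpansion` / `PolymerGasGeometric` collecting the abstract
inputs of Peierls-type LOWER bounds in convergent polymer expansions (the perimeter law for
Wilson loops in the low-temperature expansion of discrete lattice gauge theories, Seiler LNP 159
§3; Marra–Miracle-Solé 1979 for `ℤ₂`):

* `IsKPVolume.of_norm_le`: the Kotecký–Preiss condition only sees `‖w‖` and is inherited by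
  activities of smaller norm.
* `exp_neg_two_mul_sum_kpTerm_le_norm_div` (**the ratio lemma**): if `w'` differs from `w` only
  on a set `D` of polymers and `‖w'‖ ≤ ‖w‖`, then under the KP condition
  `‖Z(Λ; w') / Z(Λ; w)‖ ≥ exp (-2 ∑_{γ ∈ D} ‖w γ‖ e^{a γ})` — the observable-insertion form of the
  telescoped KP ratio bounds (`Z(Λ; w')/Z(Λ; w) = [Z(Λ∖D; w)/Z(Λ; w)] / [Z(Λ∖D; w')/Z(Λ; w')]`).
  With `D` = the polymers linking a loop this is the perimeter law mechanism.
* Real activities: `polymerPartitionFunction_ofReal`, `im_polymerPartitionFunction_eq_zero`,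
  `one_le_re_polymerPartitionFunction` (non-negative activities), and
  `re_polymerPartitionFunction_pos_of_kp` (**positivity by continuity**): if `Z(Λ'; t • w)` is
  real for `t ∈ [0, 1]` and the KP condition holds, then `Z(Λ'; w) > 0` — it is `1` at `t = 0`,
  never vanishes on `[0, 1]` (zero-freeness), and is continuous (intermediate value theorem).
* `sum_pow_card_le_of_connected_of_le_card`: the lattice-animal tail
  `∑_{Y ∋ q connected, #Y ≥ m+1} λ^{#Y} ≤ 2 λ (1/2)^m` when `(Δ+1)² λ ≤ 1/2`
  (refines `sum_pow_card_le_of_connected`).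

Everything here is proved; no named facts. (Dropping polymers of zero activity from the volume
is `polymerPartitionFunction_eq_of_subset_of_eq_zero` of `PolymerPushforward`.)

## References

* R. Kotecký, D. Preiss, Comm. Math. Phys. 103 (1986) 491–498. [KoteckyPreiss1986]
* S. Friedli, Y. Velenik, *Statistical Mechanics of Lattice Systems* (CUP 2017), Ch. 5.
  [FriedliVelenik2017]
* E. Seiler, *Gauge Theories as a Problem of Constructive Quantum Field Theory and Statistical
  Mechanics*, LNP 159 (1982), §3 (low-temperature expansions, perimeter law). [SeilerLNP1982]
-/

noncomputable section

open Finset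

namespace Literature.Probability.LatticeModels

variable {P : Type*} [DecidableEq P] {inc : P → P → Prop} [DecidableRel inc]

/-! ### The KP condition only sees the norms of the activities -/

omit [DecidableEq P] in
/-- The Kotecký–Preiss condition is inherited by activities of smaller norm (same size function).
[cite: KoteckyPreiss1986, (1)] -/
theorem IsKPVolume.of_norm_le {w w' : P → ℂ} {a : P → ℝ} {Λ : Finset P} (h : IsKPVolume inc w a Λ)
    (hle : ∀ γ ∈ Λ, ‖w' γ‖ ≤ ‖w γ‖) : IsKPVolume inc w' a Λ := by
  intro γ hγ
  refine le_trans (Finset.sum_le_sum fun γ' hγ' => ?_) (h γ hγ)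
  have hγ'Λ : γ' ∈ Λ := (Finset.mem_filter.1 hγ').1
  simp only [kpTerm]
  exact mul_le_mul_of_nonneg_right (hle γ' hγ'Λ) (Real.exp_nonneg _)

omit [DecidableEq P] in
/-- Scaling the activities by `t ∈ [0, 1]` preserves the KP condition. [folklore] -/
theorem IsKPVolume.ray {w : P → ℂ} {a : P → ℝ} {Λ : Finset P} (h : IsKPVolume inc w a Λ) {t : ℝ}
    (ht : t ∈ Set.Icc (0 : ℝ) 1) : IsKPVolume inc (fun γ => (t : ℂ) * w γ) a Λ := by
  refine h.of_norm_le fun γ _ => ?_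
  rw [norm_mul, Complex.norm_real, Real.norm_eq_abs, abs_of_nonneg ht.1]
  exact mul_le_of_le_one_left (norm_nonneg _) ht.2

/-! ### The ratio lemma: inserting a bounded modification of the activities on a set `D` -/

/-- **Ratio of partition functions with activities modified on `D`.** Let `Λ` satisfy the KP
condition for `w`, let `w'` satisfy `‖w' γ‖ ≤ ‖w γ‖` on `Λ` and agree with `w` outside `D ⊆ Λ`.
Then `exp (-2 ∑_{γ ∈ D} ‖w γ‖ e^{a γ}) ≤ ‖Z(Λ; w') / Z(Λ; w)‖`. Proof:
`Z(Λ; w')/Z(Λ; w) = [Z(Λ∖D; w)/Z(Λ; w)] / [Z(Λ∖D; w')/Z(Λ; w')]` because `Z(Λ∖D; w') = Z(Λ∖D; w)`;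
the numerator is `≥ e^{-∑_D}` and the denominator `≤ e^{∑_D}` by the telescoped KP ratio bounds
(`le_norm_polymerPartitionFunction_sdiff_div_of_kp`, `norm_polymerPartitionFunction_sdiff_div_le_of_kp`).
This is the mechanism of perimeter-law lower bounds: a Wilson loop multiplies the activities of
the polymers linking it by phases (Seiler LNP 159 §3). [folklore] -/
theorem exp_neg_two_mul_sum_kpTerm_le_norm_div [Std.Refl inc] [Std.Symm inc] {w w' : P → ℂ}
    {a : P → ℝ} {Λ D : Finset P} (hKP : IsKPVolume inc w a Λ) (hle : ∀ γ ∈ Λ, ‖w' γ‖ ≤ ‖w γ‖)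
    (hD : D ⊆ Λ) (heq : ∀ γ ∈ Λ, γ ∉ D → w' γ = w γ) :
    Real.exp (-(2 * ∑ γ ∈ D, kpTerm w a γ)) ≤
      ‖polymerPartitionFunction inc w' Λ / polymerPartitionFunction inc w Λ‖ := by
  have hKP' : IsKPVolume inc w' a Λ := hKP.of_norm_le hle
  have hZ : polymerPartitionFunction inc w Λ ≠ 0 :=
    polymerPartitionFunction_ne_zero_of_kp hKP Finset.Subset.rfl
  have hZ' : polymerPartitionFunction inc w' Λ ≠ 0 :=
    polymerPartitionFunction_ne_zero_of_kp hKP' Finset.Subset.rfl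
  have hZD : polymerPartitionFunction inc w (Λ \ D) ≠ 0 :=
    polymerPartitionFunction_ne_zero_of_kp hKP Finset.sdiff_subset
  have heqD : polymerPartitionFunction inc w' (Λ \ D) = polymerPartitionFunction inc w (Λ \ D) :=
    polymerPartitionFunction_congr fun γ hγ =>
      heq γ (Finset.mem_sdiff.1 hγ).1 (Finset.mem_sdiff.1 hγ).2
  set S : ℝ := ∑ γ ∈ D, kpTerm w a γ with hS
  -- the two telescoped KP bounds
  have h1 : ‖polymerPartitionFunction inc w' (Λ \ D) / polymerPartitionFunction inc w' Λ‖ ≤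
      Real.exp S := by
    refine (norm_polymerPartitionFunction_sdiff_div_le_of_kp hKP' Finset.Subset.rfl hD).trans
      (Real.exp_le_exp.2 (Finset.sum_le_sum fun γ hγ => ?_))
    simp only [kpTerm]
    exact mul_le_mul_of_nonneg_right (hle γ (hD hγ)) (Real.exp_nonneg _)
  have h2 : Real.exp (-S) ≤
      ‖polymerPartitionFunction inc w (Λ \ D) / polymerPartitionFunction inc w Λ‖ :=
    le_norm_polymerPartitionFunction_sdiff_div_of_kp hKP Finset.Subset.rfl hD
  -- algebra: `Z'/Z = (Z_D/Z) / (Z_D/Z')`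
  have hkey : polymerPartitionFunction inc w' Λ / polymerPartitionFunction inc w Λ =
      (polymerPartitionFunction inc w (Λ \ D) / polymerPartitionFunction inc w Λ) /
        (polymerPartitionFunction inc w' (Λ \ D) / polymerPartitionFunction inc w' Λ) := by
    rw [heqD, div_div_div_cancel_left' _ _ hZD]
  have hpos1 : 0 < ‖polymerPartitionFunction inc w' (Λ \ D) / polymerPartitionFunction inc w' Λ‖ := by
    rw [heqD]; exact norm_pos_iff.2 (div_ne_zero hZD hZ')
  rw [hkey, norm_div, le_div_iff₀ hpos1]
  calc Real.exp (-(2 * S)) *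
        ‖polymerPartitionFunction inc w' (Λ \ D) / polymerPartitionFunction inc w' Λ‖
      ≤ Real.exp (-(2 * S)) * Real.exp S :=
        mul_le_mul_of_nonneg_left h1 (Real.exp_nonneg _)
    _ = Real.exp (-S) := by rw [← Real.exp_add]; ring_nf
    _ ≤ _ := h2

/-! ### Real activities -/

/-- With real activities the partition function is the (cast of the) real partition function.
[folklore] -/
theorem polymerPartitionFunction_ofReal (wr : P → ℝ) (Λ : Finset P) :
    polymerPartitionFunction inc (fun γ => (wr γ : ℂ)) Λ =
      ((∑ A ∈ Λ.powerset, if IsCompatible inc A then ∏ γ ∈ A, wr γ else 0 : ℝ) : ℂ) := by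
  unfold polymerPartitionFunction
  rw [Complex.ofReal_sum]
  refine Finset.sum_congr rfl fun A _ => ?_
  split_ifs
  · rw [Complex.ofReal_prod]
  · rw [Complex.ofReal_zero]

/-- With real activities the partition function is real, and its real part is the real
partition function `∑_{A compatible} ∏_{γ ∈ A} Re (w γ)`. [folklore] -/
theorem re_polymerPartitionFunction_of_im_eq_zero {w : P → ℂ} (hw : ∀ γ, (w γ).im = 0)
    (Λ : Finset P) :
    (polymerPartitionFunction inc w Λ).im = 0 ∧
      (polymerPartitionFunction inc w Λ).re =
        ∑ A ∈ Λ.powerset, if IsCompatible inc A then ∏ γ ∈ A, (w γ).re else 0 := by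
  have hww : w = fun γ => (((w γ).re : ℝ) : ℂ) :=
    funext fun γ => Complex.ext (by simp) (by simp [hw γ])
  rw [hww, polymerPartitionFunction_ofReal]
  simp

/-- With real activities the partition function is real. [folklore] -/
theorem im_polymerPartitionFunction_eq_zero {w : P → ℂ} (hw : ∀ γ, (w γ).im = 0) (Λ : Finset P) :
    (polymerPartitionFunction inc w Λ).im = 0 :=
  (re_polymerPartitionFunction_of_im_eq_zero hw Λ).1

/-- With non-negative real activities, `1 ≤ Z(Λ; w)` (the empty family contributes `1`, every
other compatible family a non-negative amount); in particular `Z(Λ; w) > 0`. [folklore] -/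
theorem one_le_re_polymerPartitionFunction {w : P → ℂ} (hw : ∀ γ, (w γ).im = 0)
    (hw0 : ∀ γ, 0 ≤ (w γ).re) (Λ : Finset P) :
    1 ≤ (polymerPartitionFunction inc w Λ).re := by
  rw [(re_polymerPartitionFunction_of_im_eq_zero hw Λ).2]
  have hempty : (∅ : Finset P) ∈ Λ.powerset := Finset.empty_mem_powerset Λ
  calc (1 : ℝ) = if IsCompatible inc (∅ : Finset P) then ∏ γ ∈ (∅ : Finset P), (w γ).re else 0 := by
        rw [if_pos isCompatible_empty, Finset.prod_empty]
    _ ≤ _ := Finset.single_le_sum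
        (f := fun A => if IsCompatible inc A then ∏ γ ∈ A, (w γ).re else 0)
        (fun A _ => by
          split_ifs
          · exact Finset.prod_nonneg fun γ _ => hw0 γ
          · exact le_rfl) hempty

/-- Sub-volumes of non-negative real polymer gases have smaller partition functions.
[folklore] -/
theorem re_polymerPartitionFunction_mono {w : P → ℂ} (hw : ∀ γ, (w γ).im = 0)
    (hw0 : ∀ γ, 0 ≤ (w γ).re) {Λ Λ' : Finset P} (h : Λ' ⊆ Λ) :
    (polymerPartitionFunction inc w Λ').re ≤ (polymerPartitionFunction inc w Λ).re := by
  rw [(re_polymerPartitionFunction_of_im_eq_zero hw Λ).2,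
    (re_polymerPartitionFunction_of_im_eq_zero hw Λ').2]
  refine Finset.sum_le_sum_of_subset_of_nonneg (Finset.powerset_mono.2 h) fun A _ _ => ?_
  split_ifs
  · exact Finset.prod_nonneg fun γ _ => hw0 γ
  · exact le_rfl

/-- **Positivity by continuity.** Let `Λ` be a KP volume for `w` and `Λ' ⊆ Λ`; suppose that
`Z(Λ'; t • w)` is real for every `t ∈ [0, 1]` (e.g. because the activities come in complex
conjugate pairs exchanged by an involution of the polymers). Then `Z(Λ'; w) > 0`: the function
`t ↦ Z(Λ'; t • w)` is continuous, equals `1` at `t = 0` and never vanishes on `[0, 1]`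
(zero-freeness under the KP condition, which `t • w` inherits), so by the intermediate value
theorem it stays positive. [folklore] -/
theorem re_polymerPartitionFunction_pos_of_kp [Std.Refl inc] [Std.Symm inc] {w : P → ℂ}
    {a : P → ℝ} {Λ Λ' : Finset P} (hKP : IsKPVolume inc w a Λ) (hΛ' : Λ' ⊆ Λ)
    (hreal : ∀ t : ℝ, t ∈ Set.Icc (0 : ℝ) 1 →
      (polymerPartitionFunction inc (fun γ => (t : ℂ) * w γ) Λ').im = 0) :
    0 < (polymerPartitionFunction inc w Λ').re := by
  set f : ℝ → ℝ := fun t => (polymerPartitionFunction inc (fun γ => (t : ℂ) * w γ) Λ').re with hf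
  have hfc : Continuous f :=
    Complex.continuous_re.comp (continuous_polymerPartitionFunction_ray w Λ')
  have hf0 : f 0 = 1 := by
    simp only [hf, Complex.ofReal_zero, polymerPartitionFunction_zero_mul, Complex.one_re]
  have hf1 : f 1 = (polymerPartitionFunction inc w Λ').re := by simp [hf]
  have hne : ∀ t ∈ Set.Icc (0 : ℝ) 1,
      polymerPartitionFunction inc (fun γ => (t : ℂ) * w γ) Λ' ≠ 0 := fun t ht =>
    polymerPartitionFunction_ne_zero_of_kp (hKP.ray ht) hΛ'
  by_contra hle
  push Not at hle
  have h0mem : (0 : ℝ) ∈ Set.Icc (f 1) (f 0) := ⟨by rwa [hf1], by rw [hf0]; exact zero_le_one⟩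
  obtain ⟨t, ht, hft⟩ := intermediate_value_Icc' (zero_le_one' ℝ) hfc.continuousOn h0mem
  exact hne t ht (Complex.ext (by simpa [hf] using hft) (by simpa using hreal t ht))

/-! ### Lattice-animal tails -/

variable {V : Type*} [DecidableEq V] {R : V → V → Prop} {nbr : V → Finset V} {Δ : ℕ}

/-- **Tail of the animal sum through a cell.** If `#(nbr x) ≤ Δ`, `nbr` lists the `R`-neighbours,
`0 ≤ λ` and `(Δ + 1)² λ ≤ 1/2`, then for every finite family `𝒴` of `R`-connected sets containing
the cell `q` and of cardinality at least `m + 1`, `∑_{Y ∈ 𝒴} λ^{#Y} ≤ 2 λ (1/2)^m` (group by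
cardinality, `card_connectedFamily_le`: at most `(Δ+1)^{2j}` members of cardinality `j + 1`, and
`∑_{j ≥ m} 2^{-j} ≤ 2 · 2^{-m}`). The large-contour tail of Peierls estimates.
[cite: FriedliVelenik2017, Lemma 3.38 and eq. (5.27)] -/
theorem sum_pow_card_le_of_connected_of_le_card (hR : ∀ x y, R x y → R y x)
    (hΔ : ∀ x, (nbr x).card ≤ Δ) (hnbr : ∀ x y, R x y → y ∈ nbr x) {lam : ℝ} (hlam : 0 ≤ lam)
    (hsmall : ((Δ : ℝ) + 1) ^ 2 * lam ≤ 1 / 2) (q : V) (m : ℕ) (𝒴 : Finset (Finset V))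
    (h𝒴 : ∀ Y ∈ 𝒴, q ∈ Y ∧ IsRConnected R Y ∧ m + 1 ≤ Y.card) :
    ∑ Y ∈ 𝒴, lam ^ Y.card ≤ 2 * lam * (1 / 2) ^ m := by
  -- group by `j = #Y - 1 ∈ [m, M)`
  set M : ℕ := 𝒴.sup Finset.card with hM
  have hmaps : ∀ Y ∈ 𝒴, Y.card - 1 ∈ Finset.Ico m M := by
    intro Y hY
    have h1 := (h𝒴 Y hY).2.2
    have h2 : Y.card ≤ M := le_sup (f := Finset.card) hY
    simp only [Finset.mem_Ico]; omega
  rw [← sum_fiberwise_of_maps_to hmaps]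
  have hfiber : ∀ j ∈ Finset.Ico m M,
      ∑ Y ∈ 𝒴 with Y.card - 1 = j, lam ^ Y.card ≤ ((Δ : ℝ) + 1) ^ (2 * j) * lam ^ (j + 1) := by
    intro j _
    have hcard : (𝒴.filter fun Y => Y.card - 1 = j).card ≤ (Δ + 1) ^ (2 * j) := by
      refine card_connectedFamily_le hR hΔ hnbr q j _ fun Y hY => ?_
      obtain ⟨hY, hj⟩ := mem_filter.1 hY
      obtain ⟨hq, hconn, -⟩ := h𝒴 Y hY
      have h1 : 1 ≤ Y.card := card_pos.2 ⟨q, hq⟩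
      exact ⟨hq, by omega, fun w hw => hconn.2 q hq w hw⟩
    calc ∑ Y ∈ 𝒴 with Y.card - 1 = j, lam ^ Y.card
        = ∑ Y ∈ 𝒴 with Y.card - 1 = j, lam ^ (j + 1) := by
          refine sum_congr rfl fun Y hY => ?_
          obtain ⟨hY, hj⟩ := mem_filter.1 hY
          have h1 : 1 ≤ Y.card := card_pos.2 ⟨q, (h𝒴 Y hY).1⟩
          rw [show Y.card = j + 1 by omega]
      _ = (𝒴.filter fun Y => Y.card - 1 = j).card * lam ^ (j + 1) := by
          rw [sum_const, nsmul_eq_mul]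
      _ ≤ ((Δ + 1) ^ (2 * j) : ℕ) * lam ^ (j + 1) := by gcongr
      _ = ((Δ : ℝ) + 1) ^ (2 * j) * lam ^ (j + 1) := by push_cast; ring
  refine (sum_le_sum hfiber).trans ?_
  calc ∑ j ∈ Finset.Ico m M, ((Δ : ℝ) + 1) ^ (2 * j) * lam ^ (j + 1)
      = lam * ∑ j ∈ Finset.Ico m M, (((Δ : ℝ) + 1) ^ 2 * lam) ^ j := by
        rw [mul_sum]
        refine sum_congr rfl fun j _ => ?_
        rw [mul_pow, ← pow_mul, pow_succ]
        ring
    _ ≤ lam * ∑ j ∈ Finset.Ico m M, (1 / 2 : ℝ) ^ j := by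
        refine mul_le_mul_of_nonneg_left (sum_le_sum fun j _ => ?_) hlam
        exact pow_le_pow_left₀ (by positivity) hsmall j
    _ = lam * ((1 / 2 : ℝ) ^ m * ∑ i ∈ Finset.range (M - m), (1 / 2 : ℝ) ^ i) := by
        rw [Finset.sum_Ico_eq_sum_range]
        congr 1
        rw [mul_sum]
        exact sum_congr rfl fun i _ => pow_add _ _ _
    _ ≤ lam * ((1 / 2 : ℝ) ^ m * 2) := by
        gcongr
        exact sum_geometric_two_le _
    _ = 2 * lam * (1 / 2) ^ m := by ring

end Literature.Probability.LatticeModels
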